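import Mathlib.Analysis.SpecialFunctions.ImproperIntegrals
import Literature.Analysis.SingularIntegrals.SchurTest
import Literature.Analysis.FluidPDE.KatoWeightedDuhamel
import HarnessLib

/-!
# A Volterra inequality with the kernel `(t - s)^{-3/4} s^{-1/4}`: `L⁵` absorption

Analysis/FluidPDE support file (theorems only, everything proved). It serves the discharge of
the named fact `Literature.Analysis.FluidPDE.ess_kato_L3_local` (`NSLerayHopfProofs.lean`;
Escauriaza–Seregin–Šverák 2003, Thm. 7.4: Kato's `L³` local theory with `u ∈ L₅(Q_T)`). For
Kato's fixed point `u = e^{tΔ}a - B(u,u)` in the weighted class `s^{1/4}‖u(s)‖₆ ≤ K` one has,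
by the `L^{30/11} → L⁵` bound of the Oseen kernel and Minkowski's inequality,

  `‖u(t)‖₅ ≤ ‖e^{tΔ}a‖₅ + Λ ∫₀ᵗ (t - s)^{-3/4} s^{-1/4} ‖u(s)‖₅ ds`,   `Λ = C K`,

i.e. a linear Volterra inequality `φ ≤ ψ + Λ 𝒦φ` for `φ(t) = ‖u(t)‖₅` with the free term
`ψ(t) = ‖e^{tΔ}a‖₅ ∈ L⁵(0, T)` (Giga's estimate, `HeatFlowGigaL5.lean`) and the positive kernel
`k(t, s) = (t - s)^{-3/4} s^{-1/4}`, homogeneous of degree `-1`. This file proves the real-variable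
lemma turning it into `φ ∈ L⁵(0, T)` (**`lintegral_rpow_five_le_of_volterra`**): *if `φ` is
a priori in Kato's weighted class `φ(t) ≤ M t^{-1/5}`, `ψ` is measurable, and `Λ ≤ Λ₀` (an
absolute constant), then `∫₀ᵀ φ⁵ ≤ 32 ∫₀ᵀ ψ⁵`.* Proof: iterating the inequality,
`φ ≤ S_N + Λᴺ 𝒦ᴺφ` with `S_N = Σ_{n<N} Λⁿ𝒦ⁿψ`; the operator `𝒦` maps the weight `t^{-1/5}`
to `c t^{-1/5}` (Euler's Beta integral, tree `lintegral_Ioo_rpow_mul_rpow_le`), so the remainder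
tends to zero pointwise when `Λc < 1` and `φ ≤ sup_N S_N`; and `𝒦` is bounded on `L⁵(0,T)` by
**Schur's test** with the power test function `t^{-1/5}` (tree `SingularIntegrals/SchurTest`;
row bound = the same Beta integral, column bound = `∫ₛ^∞ (t-s)^{-3/4} t^{-1} dt ≤ 7 s^{-3/4}`),
so `‖S_N‖₅ ≤ 2‖ψ‖₅` when `Λ‖𝒦‖ ≤ 1/2`, and monotone convergence concludes. (The a priori
weighted bound is essential: `t^{-a}` solves the homogeneous equation `φ = Λ𝒦φ` for a suitable
`a = a(Λ) > 1/5`.)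

## Main statements

* `lintegral_Ioi_sub_rpow_mul_inv_le` — the column integral `∫ₛ^∞ (t-s)^{-3/4} t^{-1} dt ≤ 7 s^{-3/4}`;
* `lintegral_rpow_lintegral_quarterKernel_le` — Schur bound: `∫₀ᵀ (𝒦f)⁵ ≤ κ ∫₀ᵀ f⁵`;
* `lintegral_rpow_five_le_of_volterra` — the absorption lemma (with an absolute `Λ₀ > 0`).

## Mathlib / tree search

Tree: `lintegral_rpow_lintegral_le_of_schur` (`SingularIntegrals/SchurTest`),
`lintegral_Ioo_rpow_mul_rpow_le` (`FluidPDE/KatoWeightedDuhamel`); nothing on Volterra / Abel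
integral inequalities (`lean search -i 'volterra|abel.*kernel|gronwall.*singular'`: only
Mathlib's `gronwallBound`, regular kernels). Mathlib: `ENNReal.lintegral_Lp_add_le` (Minkowski),
`lintegral_iSup`, `ENNReal.orderIsoRpow`, `integral_Ioi_rpow_of_lt`, `integral_rpow`,
`ENNReal.tendsto_pow_atTop_nhds_zero_of_lt_one`.

## References

* L. Escauriaza, G. Seregin, V. Šverák, Russ. Math. Surveys 58:2 (2003), Appendix, Thm. 7.4,
  (7.35)–(7.40) (the iteration in `L₅(Q_T)`). [EscauriazaSereginSverak2003]
* Y. Giga, J. Differential Equations 62 (1986) 186–212 (existence in `L^r(0,T; L^q)`). [Giga1986]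
* L. Grafakos, *Modern Fourier Analysis* (2009), App. A.2 (Schur's test). [Grafakos2009]
-/

noncomputable section

open MeasureTheory Set Filter Function
open Literature.Analysis.SingularIntegrals
open scoped ENNReal NNReal Topology

namespace Literature.Analysis.FluidPDE

/-! ### The column Beta integral -/

/-- **The column integral of the kernel**: for `s > 0`,
`∫ₛ^∞ (t - s)^{-3/4} t^{-1} dt ≤ 7 s^{-3/4}` (on `(s, 2s]`: `t⁻¹ ≤ s⁻¹` and
`∫ₛ^{2s} (t-s)^{-3/4} = 4 s^{1/4}`; on `(2s, ∞)`: `(t-s)^{-3/4} ≤ 2 t^{-3/4}` and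
`∫_{2s}^∞ t^{-7/4} = (4/3)(2s)^{-3/4}`). [folklore] -/
theorem lintegral_Ioi_sub_rpow_mul_inv_le {s : ℝ} (hs : 0 < s) :
    ∫⁻ t in Ioi s, ENNReal.ofReal ((t - s) ^ (-(3 / 4 : ℝ)) * t⁻¹) ≤
      ENNReal.ofReal (7 * s ^ (-(3 / 4 : ℝ))) := by
  have h2s : s < 2 * s := by linarith
  have hsplit : Ioi s = Ioc s (2 * s) ∪ Ioi (2 * s) := (Ioc_union_Ioi_eq_Ioi h2s.le).symm
  -- part 1: `(s, 2s]`
  have h1 : ∫⁻ t in Ioc s (2 * s), ENNReal.ofReal ((t - s) ^ (-(3 / 4 : ℝ)) * t⁻¹) ≤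
      ENNReal.ofReal (4 * s ^ (-(3 / 4 : ℝ))) := by
    have hr : (-1 : ℝ) < -(3 / 4 : ℝ) := by norm_num
    have hint : IntervalIntegrable (fun t : ℝ => (t - s) ^ (-(3 / 4 : ℝ))) volume s (2 * s) := by
      have h := (intervalIntegral.intervalIntegrable_rpow' hr (a := 0) (b := s)).comp_sub_right s
      rwa [zero_add, show s + s = 2 * s by ring] at h
    have hint' : IntegrableOn (fun t : ℝ => (t - s) ^ (-(3 / 4 : ℝ))) (Ioc s (2 * s)) volume := by
      rw [← intervalIntegrable_iff_integrableOn_Ioc_of_le h2s.le]; exact hint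
    have hval : ∫ t in s..2 * s, (t - s) ^ (-(3 / 4 : ℝ)) = 4 * s ^ (1 / 4 : ℝ) := by
      rw [intervalIntegral.integral_comp_sub_right (fun t : ℝ => t ^ (-(3 / 4 : ℝ))) s, sub_self,
        show 2 * s - s = s by ring, integral_rpow (Or.inl hr), Real.zero_rpow (by norm_num), sub_zero]
      rw [show (-(3 / 4 : ℝ) + 1) = 1 / 4 by norm_num]
      field_simp
    calc ∫⁻ t in Ioc s (2 * s), ENNReal.ofReal ((t - s) ^ (-(3 / 4 : ℝ)) * t⁻¹)
        ≤ ∫⁻ t in Ioc s (2 * s), ENNReal.ofReal ((t - s) ^ (-(3 / 4 : ℝ))) * ENNReal.ofReal s⁻¹ := by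
          refine setLIntegral_mono' measurableSet_Ioc fun t ht => ?_
          rw [← ENNReal.ofReal_mul (Real.rpow_nonneg (sub_nonneg.2 ht.1.le) _)]
          refine ENNReal.ofReal_le_ofReal (mul_le_mul_of_nonneg_left ?_ (Real.rpow_nonneg (sub_nonneg.2 ht.1.le) _))
          exact inv_anti₀ hs ht.1.le
      _ = ENNReal.ofReal (∫ t in s..2 * s, (t - s) ^ (-(3 / 4 : ℝ))) * ENNReal.ofReal s⁻¹ := by
          rw [lintegral_mul_const' _ _ ENNReal.ofReal_ne_top, intervalIntegral.integral_of_le h2s.le,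
            ofReal_integral_eq_lintegral_ofReal hint' ((ae_restrict_iff' measurableSet_Ioc).2
              (Eventually.of_forall fun t ht => Real.rpow_nonneg (sub_nonneg.2 ht.1.le) _))]
      _ = ENNReal.ofReal (4 * s ^ (-(3 / 4 : ℝ))) := by
          rw [hval, ← ENNReal.ofReal_mul (by positivity)]
          congr 1
          rw [show (-(3 / 4 : ℝ)) = 1 / 4 + (-1) by norm_num, Real.rpow_add hs, Real.rpow_neg_one]
          ring
  -- part 2: `(2s, ∞)`
  have h2 : ∫⁻ t in Ioi (2 * s), ENNReal.ofReal ((t - s) ^ (-(3 / 4 : ℝ)) * t⁻¹) ≤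
      ENNReal.ofReal (8 / 3 * s ^ (-(3 / 4 : ℝ))) := by
    have hpt : ∀ t ∈ Ioi (2 * s), ENNReal.ofReal ((t - s) ^ (-(3 / 4 : ℝ)) * t⁻¹) ≤
        ENNReal.ofReal 2 * ENNReal.ofReal (t ^ (-(7 / 4 : ℝ))) := by
      intro t ht
      have ht0 : 0 < t := by linarith [mem_Ioi.1 ht]
      have hts : t / 2 ≤ t - s := by linarith [mem_Ioi.1 ht]
      rw [← ENNReal.ofReal_mul zero_le_two]
      refine ENNReal.ofReal_le_ofReal ?_
      have h1 : (t - s) ^ (-(3 / 4 : ℝ)) ≤ (t / 2) ^ (-(3 / 4 : ℝ)) :=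
        Real.rpow_le_rpow_of_nonpos (by positivity) hts (by norm_num)
      have h2 : (t / 2) ^ (-(3 / 4 : ℝ)) ≤ 2 * t ^ (-(3 / 4 : ℝ)) := by
        rw [Real.div_rpow ht0.le zero_le_two, div_le_iff₀ (Real.rpow_pos_of_pos two_pos _)]
        have h22 : (1 : ℝ) ≤ 2 * (2 : ℝ) ^ (-(3 / 4 : ℝ)) := by
          have : (2 : ℝ) ^ (-(3 / 4 : ℝ)) ≥ 2 ^ (-1 : ℝ) :=
            Real.rpow_le_rpow_of_exponent_le one_le_two (by norm_num)
          rw [Real.rpow_neg_one] at this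
          linarith
        nlinarith [Real.rpow_nonneg ht0.le (-(3 / 4 : ℝ))]
      have h74 : t ^ (-(7 / 4 : ℝ)) = t ^ (-(3 / 4 : ℝ)) * t⁻¹ := by
        rw [show (-(7 / 4 : ℝ)) = -(3 / 4 : ℝ) + (-1) by norm_num, Real.rpow_add ht0, Real.rpow_neg_one]
      rw [h74]
      calc (t - s) ^ (-(3 / 4 : ℝ)) * t⁻¹ ≤ (2 * t ^ (-(3 / 4 : ℝ))) * t⁻¹ :=
            mul_le_mul_of_nonneg_right (h1.trans h2) (inv_nonneg.2 ht0.le)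
        _ = 2 * (t ^ (-(3 / 4 : ℝ)) * t⁻¹) := by ring
    have h2s0 : 0 < 2 * s := by linarith
    have hint : IntegrableOn (fun t : ℝ => t ^ (-(7 / 4 : ℝ))) (Ioi (2 * s)) volume :=
      integrableOn_Ioi_rpow_of_lt (by norm_num) h2s0
    calc ∫⁻ t in Ioi (2 * s), ENNReal.ofReal ((t - s) ^ (-(3 / 4 : ℝ)) * t⁻¹)
        ≤ ∫⁻ t in Ioi (2 * s), ENNReal.ofReal 2 * ENNReal.ofReal (t ^ (-(7 / 4 : ℝ))) :=
          setLIntegral_mono' measurableSet_Ioi hpt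
      _ = ENNReal.ofReal 2 * ENNReal.ofReal (∫ t in Ioi (2 * s), t ^ (-(7 / 4 : ℝ))) := by
          rw [lintegral_const_mul' _ _ ENNReal.ofReal_ne_top,
            ofReal_integral_eq_lintegral_ofReal hint ((ae_restrict_iff' measurableSet_Ioi).2
              (Eventually.of_forall fun t ht => Real.rpow_nonneg (h2s0.trans (mem_Ioi.1 ht)).le _))]
      _ = ENNReal.ofReal (8 / 3 * (2 * s) ^ (-(3 / 4 : ℝ))) := by
          rw [integral_Ioi_rpow_of_lt (by norm_num) h2s0, ← ENNReal.ofReal_mul zero_le_two]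
          congr 1
          rw [show (-(7 / 4 : ℝ) + 1) = -(3 / 4 : ℝ) by norm_num]
          ring
      _ ≤ ENNReal.ofReal (8 / 3 * s ^ (-(3 / 4 : ℝ))) := by
          refine ENNReal.ofReal_le_ofReal (mul_le_mul_of_nonneg_left ?_ (by norm_num))
          exact Real.rpow_le_rpow_of_nonpos hs h2s.le (by norm_num)
  calc ∫⁻ t in Ioi s, ENNReal.ofReal ((t - s) ^ (-(3 / 4 : ℝ)) * t⁻¹)
      ≤ (∫⁻ t in Ioc s (2 * s), ENNReal.ofReal ((t - s) ^ (-(3 / 4 : ℝ)) * t⁻¹)) +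
          ∫⁻ t in Ioi (2 * s), ENNReal.ofReal ((t - s) ^ (-(3 / 4 : ℝ)) * t⁻¹) := by
        rw [hsplit]; exact lintegral_union_le _ _ _
    _ ≤ ENNReal.ofReal (4 * s ^ (-(3 / 4 : ℝ))) + ENNReal.ofReal (8 / 3 * s ^ (-(3 / 4 : ℝ))) :=
        add_le_add h1 h2
    _ ≤ ENNReal.ofReal (7 * s ^ (-(3 / 4 : ℝ))) := by
        rw [← ENNReal.ofReal_add (by positivity) (by positivity)]
        exact ENNReal.ofReal_le_ofReal (by nlinarith [Real.rpow_nonneg hs.le (-(3 / 4 : ℝ))])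

/-! ### The kernel on `(0, T) × (0, T)` and Schur's test -/

/-- The row Beta integral with an extra power weight: for `t > 0` and `0 ≤ b < 3/4`,
`∫₀ᵗ (t-s)^{-3/4} s^{-1/4} s^{-b} ds ≤ 2 (4 + 1/(3/4 - b)) t^{-b}` (tree
`lintegral_Ioo_rpow_mul_rpow_le` with `β = 1/4 + b`). [folklore] -/
theorem lintegral_quarterKernel_mul_rpow_le {b : ℝ} (hb0 : 0 ≤ b) (hb : b < 3 / 4) {t : ℝ} (ht : 0 < t) :
    ∫⁻ s in Ioo 0 t, ENNReal.ofReal ((t - s) ^ (-(3 / 4 : ℝ)) * s ^ (-(1 / 4 : ℝ))) *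
        ENNReal.ofReal (s ^ (-b)) ≤
      ENNReal.ofReal (2 * (1 / (1 - 3 / 4) + 1 / (1 - (1 / 4 + b))) * t ^ (-b)) := by
  have h := KatoL3.lintegral_Ioo_rpow_mul_rpow_le (α := 3 / 4) (β := 1 / 4 + b) (by norm_num) (by norm_num)
    (by linarith) (by linarith) ht
  rw [show (1 - 3 / 4 - (1 / 4 + b) : ℝ) = -b by ring] at h
  refine le_trans (le_of_eq ?_) h
  refine setLIntegral_congr_fun measurableSet_Ioo fun s hs => ?_
  rw [← ENNReal.ofReal_mul (mul_nonneg (Real.rpow_nonneg (sub_nonneg.2 hs.2.le) _) (Real.rpow_nonneg hs.1.le _)),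
    mul_assoc, ← Real.rpow_add hs.1]
  congr 2
  ring

/-- **Schur bound for the Volterra operator with kernel `(t-s)^{-3/4} s^{-1/4}` on `L⁵(0, T)`**:
for measurable `f ≥ 0`,
`∫₀ᵀ (∫₀ᵗ (t-s)^{-3/4} s^{-1/4} f(s) ds)⁵ dt ≤ κ ∫₀ᵀ f⁵` with an absolute constant `κ`
(Schur's test, Grafakos 2009 App. A.2, with the test function `t^{-1/5}` on both sides,
`p = 5`, `p' = 5/4`: the row bound is the Beta integral `∫₀ᵗ (t-s)^{-3/4}s^{-1/2} ≤ 12 t^{-1/4}`,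
the column bound is `s^{-1/4} ∫ₛ^∞ (t-s)^{-3/4} t^{-1} ≤ 7 s^{-1}`). [cite: Grafakos2009, Appendix A.2] -/
theorem lintegral_rpow_lintegral_quarterKernel_le {T : ℝ} {f : ℝ → ℝ≥0∞} (hf : Measurable f) :
    ∫⁻ t in Ioo 0 T, (∫⁻ s in Ioo 0 t, ENNReal.ofReal ((t - s) ^ (-(3 / 4 : ℝ)) * s ^ (-(1 / 4 : ℝ))) * f s) ^ (5 : ℝ) ≤
      (ENNReal.ofReal (2 * (1 / (1 - 3 / 4) + 1 / (1 - (1 / 4 + 1 / 4))))) ^ ((5 : ℝ) / (5 / 4)) *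
        ENNReal.ofReal 7 * ∫⁻ s in Ioo 0 T, f s ^ (5 : ℝ) := by
  -- the kernel on `ℝ × ℝ`
  set k : ℝ → ℝ → ℝ≥0∞ := fun t s => ENNReal.ofReal ((t - s) ^ (-(3 / 4 : ℝ)) * s ^ (-(1 / 4 : ℝ))) with hk
  set K : ℝ → ℝ → ℝ≥0∞ := fun t s => if s < t then k t s else 0 with hK
  have hkm : Measurable (uncurry k) := by
    refine ENNReal.measurable_ofReal.comp ?_
    exact ((measurable_fst.sub measurable_snd).pow_const _).mul (measurable_snd.pow_const _)
  have hKm : Measurable (uncurry K) := by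
    refine Measurable.ite (measurableSet_lt measurable_snd measurable_fst) hkm measurable_const
  set μ : Measure ℝ := volume.restrict (Ioo 0 T) with hμ
  -- `∫ K t s g s ds` over `(0,T)` is the Volterra integral over `(0,t)` for `t ≤ T`
  have hKint : ∀ {t : ℝ}, t ≤ T → ∀ g : ℝ → ℝ≥0∞,
      ∫⁻ s, K t s * g s ∂μ = ∫⁻ s in Ioo 0 t, k t s * g s := by
    intro t htT g
    have hind : (fun s => K t s * g s) = (Iio t).indicator (fun s => k t s * g s) := by
      funext s
      simp only [hK, indicator, mem_Iio]
      split_ifs <;> simp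
    rw [hind, hμ, lintegral_indicator measurableSet_Iio, Measure.restrict_restrict measurableSet_Iio]
    congr 1
    rw [show Iio t ∩ Ioo 0 T = Ioo 0 t from ?_]
    ext s
    simp only [mem_inter_iff, mem_Iio, mem_Ioo]
    constructor
    · rintro ⟨h1, h2, _⟩; exact ⟨h2, h1⟩
    · rintro ⟨h1, h2⟩; exact ⟨h2, h1, h2.trans_le htT⟩
  -- `∫ K t s g t dt` over `(0,T)` is at most the integral over `(s, ∞)`
  have hKcol : ∀ (s : ℝ) (g : ℝ → ℝ≥0∞), ∫⁻ t, K t s * g t ∂μ ≤ ∫⁻ t in Ioi s, k t s * g t := by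
    intro s g
    have hind : (fun t => K t s * g t) = (Ioi s).indicator (fun t => k t s * g t) := by
      funext t
      simp only [hK, indicator, mem_Ioi]
      split_ifs <;> simp
    rw [hind, hμ, lintegral_indicator measurableSet_Ioi, Measure.restrict_restrict measurableSet_Ioi]
    exact lintegral_mono_set inter_subset_left
  -- Schur's test
  have hpq : (5 : ℝ).HolderConjugate (5 / 4) := by rw [Real.holderConjugate_iff]; norm_num
  set w : ℝ → ℝ≥0∞ := fun t => ENNReal.ofReal (t ^ (-(1 / 5 : ℝ))) with hw
  have hwm : Measurable w := ENNReal.measurable_ofReal.comp (measurable_id.pow_const _)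
  have hw0 : ∀ᵐ s ∂μ, w s ≠ 0 := by
    rw [hμ, ae_restrict_iff' measurableSet_Ioo]
    exact Eventually.of_forall fun s hs => (ENNReal.ofReal_pos.2 (Real.rpow_pos_of_pos hs.1 _)).ne'
  have hwtop : ∀ᵐ s ∂μ, w s ≠ ⊤ := Eventually.of_forall fun s => ENNReal.ofReal_ne_top
  have hwq : ∀ {s : ℝ}, 0 < s → w s ^ (5 / 4 : ℝ) = ENNReal.ofReal (s ^ (-(1 / 4 : ℝ))) := by
    intro s hs
    rw [hw]; dsimp only
    rw [ENNReal.ofReal_rpow_of_nonneg (Real.rpow_nonneg hs.le _) (by norm_num), ← Real.rpow_mul hs.le]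
    norm_num
  have hwp : ∀ {s : ℝ}, 0 < s → w s ^ (5 : ℝ) = ENNReal.ofReal s⁻¹ := by
    intro s hs
    rw [hw]; dsimp only
    rw [ENNReal.ofReal_rpow_of_nonneg (Real.rpow_nonneg hs.le _) (by norm_num), ← Real.rpow_mul hs.le,
      ← Real.rpow_neg_one]
    norm_num
  set C₁ : ℝ≥0∞ := ENNReal.ofReal (2 * (1 / (1 - 3 / 4) + 1 / (1 - (1 / 4 + 1 / 4)))) with hC₁
  have hrow : ∀ᵐ t ∂μ, ∫⁻ s, K t s * w s ^ (5 / 4 : ℝ) ∂μ ≤ C₁ * w t ^ (5 / 4 : ℝ) := by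
    rw [hμ, ae_restrict_iff' measurableSet_Ioo]
    refine Eventually.of_forall fun t ht => ?_
    rw [← hμ, hKint ht.2.le, hwq ht.1]
    calc ∫⁻ s in Ioo 0 t, k t s * w s ^ (5 / 4 : ℝ)
        = ∫⁻ s in Ioo 0 t, k t s * ENNReal.ofReal (s ^ (-(1 / 4 : ℝ))) :=
          setLIntegral_congr_fun measurableSet_Ioo fun s hs => by rw [hwq hs.1]
      _ ≤ ENNReal.ofReal (2 * (1 / (1 - 3 / 4) + 1 / (1 - (1 / 4 + 1 / 4))) * t ^ (-(1 / 4 : ℝ))) :=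
          lintegral_quarterKernel_mul_rpow_le (by norm_num) (by norm_num) ht.1
      _ = C₁ * ENNReal.ofReal (t ^ (-(1 / 4 : ℝ))) := by
          rw [hC₁, ← ENNReal.ofReal_mul (by norm_num)]
  have hcol : ∀ᵐ s ∂μ, ∫⁻ t, K t s * w t ^ (5 : ℝ) ∂μ ≤ ENNReal.ofReal 7 * w s ^ (5 : ℝ) := by
    rw [hμ, ae_restrict_iff' measurableSet_Ioo]
    refine Eventually.of_forall fun s hs => ?_
    rw [← hμ, hwp hs.1]
    calc ∫⁻ t, K t s * w t ^ (5 : ℝ) ∂μ ≤ ∫⁻ t in Ioi s, k t s * w t ^ (5 : ℝ) := hKcol s _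
      _ = ∫⁻ t in Ioi s, ENNReal.ofReal (s ^ (-(1 / 4 : ℝ))) * ENNReal.ofReal ((t - s) ^ (-(3 / 4 : ℝ)) * t⁻¹) := by
          refine setLIntegral_congr_fun measurableSet_Ioi fun t ht => ?_
          have ht0 : 0 < t := hs.1.trans (mem_Ioi.1 ht)
          rw [hwp ht0, hk]; dsimp only
          rw [← ENNReal.ofReal_mul (mul_nonneg (Real.rpow_nonneg (sub_nonneg.2 (le_of_lt (mem_Ioi.1 ht))) _)
            (Real.rpow_nonneg hs.1.le _)), ← ENNReal.ofReal_mul (Real.rpow_nonneg hs.1.le _)]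
          congr 1; ring
      _ ≤ ENNReal.ofReal (s ^ (-(1 / 4 : ℝ))) * ENNReal.ofReal (7 * s ^ (-(3 / 4 : ℝ))) := by
          rw [lintegral_const_mul' _ _ ENNReal.ofReal_ne_top]
          gcongr
          exact lintegral_Ioi_sub_rpow_mul_inv_le hs.1
      _ = ENNReal.ofReal 7 * ENNReal.ofReal s⁻¹ := by
          rw [← ENNReal.ofReal_mul (Real.rpow_nonneg hs.1.le _), ← ENNReal.ofReal_mul (by norm_num)]
          congr 1
          rw [← Real.rpow_neg_one, show (-1 : ℝ) = -(1 / 4 : ℝ) + -(3 / 4 : ℝ) by norm_num, Real.rpow_add hs.1]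
          ring
  have hS := lintegral_rpow_lintegral_le_of_schur (μ := μ) (ν := μ) hpq hKm hwm hwm hw0 hwtop hrow hcol hf
  -- rewrite the inner integral
  calc ∫⁻ t in Ioo 0 T, (∫⁻ s in Ioo 0 t, k t s * f s) ^ (5 : ℝ)
      = ∫⁻ t, (∫⁻ s, K t s * f s ∂μ) ^ (5 : ℝ) ∂μ := by
        rw [hμ]
        refine (setLIntegral_congr_fun measurableSet_Ioo fun t ht => ?_).symm
        rw [← hμ, hKint ht.2.le]
    _ ≤ C₁ ^ ((5 : ℝ) / (5 / 4)) * ENNReal.ofReal 7 * ∫⁻ s, f s ^ (5 : ℝ) ∂μ := hS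

/-! ### The absorption lemma -/

/-- **`L⁵` absorption for the Volterra inequality `φ ≤ ψ + Λ 𝒦φ`** with the kernel
`k(t,s) = (t-s)^{-3/4} s^{-1/4}` (the real-variable core of the `L₅(Q_T)` integrability of
Kato's mild solution, ESS 2003, Thm. 7.4 (7.31); Giga 1986). There is an absolute constant
`Λ₀ > 0` such that: if `φ, ψ : ℝ → [0, ∞]` are measurable, `φ(t) ≤ M t^{-1/5}` on `(0, T)`
(Kato's weighted class), `Λ ≤ Λ₀`, and
`φ(t) ≤ ψ(t) + Λ ∫₀ᵗ (t-s)^{-3/4} s^{-1/4} φ(s) ds` for `t ∈ (0, T)`, then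
`∫₀ᵀ φ⁵ ≤ 32 ∫₀ᵀ ψ⁵`. Proof: iterate (`φ ≤ S_N + Λᴺ𝒦ᴺφ`), kill the remainder pointwise with the
weighted bound `𝒦(s^{-1/5}) ≤ c t^{-1/5}` (`Λ c ≤ 1/2`), bound `‖S_N‖₅ ≤ 2‖ψ‖₅` by Minkowski and
the Schur bound (`Λ κ^{1/5} ≤ 1/2`), and pass to the limit by monotone convergence.
[cite: EscauriazaSereginSverak2003, Thm. 7.4 (7.38)–(7.40)] -/
theorem lintegral_rpow_five_le_of_volterra :
    ∃ Λ₀ : ℝ≥0∞, 0 < Λ₀ ∧ ∀ {T : ℝ} {φ ψ : ℝ → ℝ≥0∞}, Measurable φ → Measurable ψ →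
      ∀ {M : ℝ}, 0 ≤ M → (∀ t ∈ Ioo 0 T, φ t ≤ ENNReal.ofReal (M * t ^ (-(1 / 5 : ℝ)))) →
      ∀ {Λ : ℝ≥0∞}, Λ ≤ Λ₀ →
      (∀ t ∈ Ioo 0 T, φ t ≤ ψ t +
        Λ * ∫⁻ s in Ioo 0 t, ENNReal.ofReal ((t - s) ^ (-(3 / 4 : ℝ)) * s ^ (-(1 / 4 : ℝ))) * φ s) →
      ∫⁻ t in Ioo 0 T, φ t ^ (5 : ℝ) ≤ 32 * ∫⁻ t in Ioo 0 T, ψ t ^ (5 : ℝ) := by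
  -- the two constants of the operator `𝒦`
  set cX : ℝ≥0∞ := ENNReal.ofReal (2 * (1 / (1 - 3 / 4) + 1 / (1 - (1 / 4 + 1 / 5)))) with hcX
  set κ : ℝ≥0∞ := (ENNReal.ofReal (2 * (1 / (1 - 3 / 4) + 1 / (1 - (1 / 4 + 1 / 4))))) ^ ((5 : ℝ) / (5 / 4)) *
      ENNReal.ofReal 7 with hκ
  have hcXt : cX ≠ ⊤ := ENNReal.ofReal_ne_top
  have hκt : κ ≠ ⊤ := ENNReal.mul_ne_top (ENNReal.rpow_ne_top_of_nonneg (by norm_num) ENNReal.ofReal_ne_top)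
    ENNReal.ofReal_ne_top
  set κ' : ℝ≥0∞ := κ ^ (1 / 5 : ℝ) with hκ'
  have hκ't : κ' ≠ ⊤ := ENNReal.rpow_ne_top_of_nonneg (by norm_num) hκt
  -- `Λ₀ = min (1/(2 cX)) (1/(2 κ'))`
  set Λ₀ : ℝ≥0∞ := min (2 * cX)⁻¹ (2 * κ')⁻¹ with hΛ₀
  have hΛ₀pos : 0 < Λ₀ := lt_min (ENNReal.inv_pos.2 (ENNReal.mul_ne_top ENNReal.ofNat_ne_top hcXt))
    (ENNReal.inv_pos.2 (ENNReal.mul_ne_top ENNReal.ofNat_ne_top hκ't))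
  refine ⟨Λ₀, hΛ₀pos, ?_⟩
  intro T φ ψ hφm hψm M hM hφM Λ hΛ hineq
  have hΛcX : Λ * cX ≤ 2⁻¹ := by
    calc Λ * cX ≤ (2 * cX)⁻¹ * cX := by gcongr; exact hΛ.trans (min_le_left _ _)
      _ ≤ 2⁻¹ := by
          by_cases h0 : cX = 0
          · simp [h0]
          · rw [ENNReal.mul_inv (Or.inl two_ne_zero) (Or.inl ENNReal.ofNat_ne_top), mul_assoc,
              ENNReal.inv_mul_cancel h0 hcXt, mul_one]
  have hΛκ : Λ * κ' ≤ 2⁻¹ := by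
    calc Λ * κ' ≤ (2 * κ')⁻¹ * κ' := by gcongr; exact hΛ.trans (min_le_right _ _)
      _ ≤ 2⁻¹ := by
          by_cases h0 : κ' = 0
          · simp [h0]
          · rw [ENNReal.mul_inv (Or.inl two_ne_zero) (Or.inl ENNReal.ofNat_ne_top), mul_assoc,
              ENNReal.inv_mul_cancel h0 hκ't, mul_one]
  have hcX0 : cX ≠ 0 := (ENNReal.ofReal_pos.2 (by norm_num)).ne'
  have hΛt : Λ ≠ ⊤ := by
    intro h
    rw [h, ENNReal.top_mul hcX0] at hΛcX
    exact absurd hΛcX (by simp)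
  -- ### the operator
  set k : ℝ → ℝ → ℝ≥0∞ := fun t s => ENNReal.ofReal ((t - s) ^ (-(3 / 4 : ℝ)) * s ^ (-(1 / 4 : ℝ))) with hk
  set K : ℝ → ℝ → ℝ≥0∞ := fun t s => if s < t then k t s else 0 with hK
  have hkm : Measurable (uncurry k) := by
    refine ENNReal.measurable_ofReal.comp ?_
    exact ((measurable_fst.sub measurable_snd).pow_const _).mul (measurable_snd.pow_const _)
  have hKm : Measurable (uncurry K) :=
    Measurable.ite (measurableSet_lt measurable_snd measurable_fst) hkm measurable_const
  set μ : Measure ℝ := volume.restrict (Ioo 0 T) with hμ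
  set Kop : (ℝ → ℝ≥0∞) → ℝ → ℝ≥0∞ := fun g t => ∫⁻ s, K t s * g s ∂μ with hKop
  have hKint : ∀ {t : ℝ}, t ≤ T → ∀ g : ℝ → ℝ≥0∞, Kop g t = ∫⁻ s in Ioo 0 t, k t s * g s := by
    intro t htT g
    have hind : (fun s => K t s * g s) = (Iio t).indicator (fun s => k t s * g s) := by
      funext s
      simp only [hK, indicator, mem_Iio]
      split_ifs <;> simp
    simp only [hKop]
    rw [hind, hμ, lintegral_indicator measurableSet_Iio, Measure.restrict_restrict measurableSet_Iio]
    congr 1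
    rw [show Iio t ∩ Ioo 0 T = Ioo 0 t from ?_]
    ext s
    simp only [mem_inter_iff, mem_Iio, mem_Ioo]
    constructor
    · rintro ⟨h1, h2, _⟩; exact ⟨h2, h1⟩
    · rintro ⟨h1, h2⟩; exact ⟨h2, h1, h2.trans_le htT⟩
  -- (P1) measurability
  have hKop_meas : ∀ {g : ℝ → ℝ≥0∞}, Measurable g → Measurable (Kop g) := by
    intro g hg
    exact (hKm.mul (hg.comp measurable_snd)).lintegral_prod_right'
  -- (P2) monotonicity (values on `(0,T)` only)
  have hKop_mono : ∀ {g₁ g₂ : ℝ → ℝ≥0∞}, (∀ s ∈ Ioo 0 T, g₁ s ≤ g₂ s) → ∀ t, Kop g₁ t ≤ Kop g₂ t := by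
    intro g₁ g₂ h t
    simp only [hKop, hμ]
    exact setLIntegral_mono' measurableSet_Ioo fun s hs => mul_le_mul' le_rfl (h s hs)
  -- (P3) additivity, (P4) homogeneity
  have hKop_add : ∀ {g₁ g₂ : ℝ → ℝ≥0∞}, Measurable g₁ → ∀ t, Kop (g₁ + g₂) t = Kop g₁ t + Kop g₂ t := by
    intro g₁ g₂ hg₁ t
    simp only [hKop, Pi.add_apply, mul_add]
    exact lintegral_add_left ((hKm.comp (measurable_const.prodMk measurable_id)).mul hg₁) _
  have hKop_smul : ∀ (c : ℝ≥0∞) (g : ℝ → ℝ≥0∞), c ≠ ⊤ → ∀ t, Kop (fun s => c * g s) t = c * Kop g t := by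
    intro c g hc t
    simp only [hKop]
    rw [← lintegral_const_mul' _ _ hc]
    exact lintegral_congr fun s => by ring
  -- (P5) the weight `w(t) = M t^{-1/5}`
  set w : ℝ → ℝ≥0∞ := fun t => ENNReal.ofReal (M * t ^ (-(1 / 5 : ℝ))) with hw
  have hKop_w : ∀ t ∈ Ioo 0 T, Kop w t ≤ cX * w t := by
    intro t ht
    rw [hKint ht.2.le]
    calc ∫⁻ s in Ioo 0 t, k t s * w s
        = ∫⁻ s in Ioo 0 t, ENNReal.ofReal M * (k t s * ENNReal.ofReal (s ^ (-(1 / 5 : ℝ)))) := by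
          refine setLIntegral_congr_fun measurableSet_Ioo fun s hs => ?_
          simp only [hw, hk]
          rw [ENNReal.ofReal_mul hM]; ring
      _ = ENNReal.ofReal M * ∫⁻ s in Ioo 0 t, k t s * ENNReal.ofReal (s ^ (-(1 / 5 : ℝ))) :=
          lintegral_const_mul' _ _ ENNReal.ofReal_ne_top
      _ ≤ ENNReal.ofReal M * ENNReal.ofReal (2 * (1 / (1 - 3 / 4) + 1 / (1 - (1 / 4 + 1 / 5))) * t ^ (-(1 / 5 : ℝ))) := by
          gcongr
          exact lintegral_quarterKernel_mul_rpow_le (by norm_num) (by norm_num) ht.1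
      _ = cX * w t := by
          simp only [hcX, hw]
          rw [ENNReal.ofReal_mul (by norm_num), ENNReal.ofReal_mul hM]; ring
  -- iterates of `Kop` on `φ` stay in the weighted class
  have hiter : ∀ n : ℕ, ∀ t ∈ Ioo 0 T, (Kop^[n] φ) t ≤ cX ^ n * w t := by
    intro n
    induction n with
    | zero => intro t ht; simpa [hw] using hφM t ht
    | succ n ih =>
        intro t ht
        rw [Function.iterate_succ_apply']
        calc Kop (Kop^[n] φ) t ≤ Kop (fun s => cX ^ n * w s) t := hKop_mono ih t
          _ = cX ^ n * Kop w t := hKop_smul _ _ (ENNReal.pow_ne_top hcXt) t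
          _ ≤ cX ^ n * (cX * w t) := mul_le_mul' le_rfl (hKop_w t ht)
          _ = cX ^ (n + 1) * w t := by ring
  -- ### the partial sums `S_N = Σ_{n<N} Λⁿ Kopⁿ ψ`, as iterates of `g ↦ ψ + Λ Kop g` at `0`
  set Φ : (ℝ → ℝ≥0∞) → ℝ → ℝ≥0∞ := fun g t => ψ t + Λ * Kop g t with hΦ
  set S : ℕ → ℝ → ℝ≥0∞ := fun N => Φ^[N] 0 with hSdef
  have hS_succ : ∀ N t, S (N + 1) t = ψ t + Λ * Kop (S N) t := by
    intro N t; simp only [hSdef, Function.iterate_succ_apply', hΦ]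
  have hS_meas : ∀ N, Measurable (S N) := by
    intro N
    induction N with
    | zero =>
        show Measurable (Φ^[0] 0)
        simp only [Function.iterate_zero, id_eq]
        exact measurable_const
    | succ N ih =>
        have : S (N + 1) = fun t => ψ t + Λ * Kop (S N) t := funext (hS_succ N)
        rw [this]
        exact hψm.add ((hKop_meas ih).const_mul _)
  have hS_mono : ∀ N t, S N t ≤ S (N + 1) t := by
    intro N
    induction N with
    | zero => intro t; simp [hSdef]
    | succ N ih =>
        intro t
        rw [hS_succ N, hS_succ (N + 1)]
        gcongr
        exact hKop_mono (fun s _ => ih s) t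
  have hS_mono' : Monotone S := monotone_nat_of_le_succ fun N => fun t => hS_mono N t
  -- the iterated inequality `φ ≤ S_N + Λᴺ Kopᴺ φ` on `(0,T)`
  have hmain : ∀ N : ℕ, ∀ t ∈ Ioo 0 T, φ t ≤ S N t + Λ ^ N * (Kop^[N] φ) t := by
    intro N
    induction N with
    | zero => intro t _; simp [hSdef]
    | succ N ih =>
        intro t ht
        have hmeasE : Measurable (S N) := hS_meas N
        calc φ t ≤ ψ t + Λ * Kop φ t := by rw [hKint ht.2.le]; exact hineq t ht
          _ ≤ ψ t + Λ * Kop (S N + fun s => Λ ^ N * (Kop^[N] φ) s) t := by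
              gcongr
              exact hKop_mono (fun s hs => by simpa using ih s hs) t
          _ = ψ t + Λ * (Kop (S N) t + Λ ^ N * Kop (Kop^[N] φ) t) := by
              rw [hKop_add hmeasE, hKop_smul _ _ (ENNReal.pow_ne_top hΛt)]
          _ = S (N + 1) t + Λ ^ (N + 1) * (Kop^[N + 1] φ) t := by
              rw [hS_succ, Function.iterate_succ_apply', mul_add, pow_succ]; ring
  -- the remainder tends to zero, so `φ ≤ sup_N S_N` on `(0,T)`
  have hlim : ∀ t ∈ Ioo 0 T, φ t ≤ ⨆ N, S N t := by
    intro t ht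
    have hrem : ∀ N, Λ ^ N * (Kop^[N] φ) t ≤ (Λ * cX) ^ N * w t := by
      intro N
      calc Λ ^ N * (Kop^[N] φ) t ≤ Λ ^ N * (cX ^ N * w t) := mul_le_mul' le_rfl (hiter N t ht)
        _ = (Λ * cX) ^ N * w t := by rw [mul_pow]; ring
    have hq : Λ * cX < 1 := hΛcX.trans_lt (by norm_num)
    have htend : Tendsto (fun N => (Λ * cX) ^ N * w t) atTop (𝓝 0) := by
      have h := ENNReal.Tendsto.mul_const (ENNReal.tendsto_pow_atTop_nhds_zero_of_lt_one hq)
        (Or.inr (ENNReal.ofReal_ne_top : w t ≠ ⊤))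
      rwa [zero_mul] at h
    have hle : ∀ N, φ t ≤ (⨆ N, S N t) + (Λ * cX) ^ N * w t := fun N =>
      (hmain N t ht).trans (add_le_add (le_iSup (fun N => S N t) N) (hrem N))
    have h2 : Tendsto (fun N => (⨆ N, S N t) + (Λ * cX) ^ N * w t) atTop (𝓝 ((⨆ N, S N t) + 0)) :=
      tendsto_const_nhds.add htend
    rw [add_zero] at h2
    exact ge_of_tendsto' h2 hle
  -- ### the `L⁵` bounds: `‖S_N‖₅ ≤ 2 ‖ψ‖₅`
  set N₅ : (ℝ → ℝ≥0∞) → ℝ≥0∞ := fun g => (∫⁻ t, g t ^ (5 : ℝ) ∂μ) ^ (1 / 5 : ℝ) with hN₅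
  have hSchur : ∀ {g : ℝ → ℝ≥0∞}, Measurable g → N₅ (Kop g) ≤ κ' * N₅ g := by
    intro g hg
    have h := lintegral_rpow_lintegral_quarterKernel_le (T := T) hg
    have h' : ∫⁻ t, Kop g t ^ (5 : ℝ) ∂μ ≤ κ * ∫⁻ s, g s ^ (5 : ℝ) ∂μ := by
      rw [hμ]
      calc ∫⁻ t in Ioo 0 T, Kop g t ^ (5 : ℝ)
          = ∫⁻ t in Ioo 0 T, (∫⁻ s in Ioo 0 t, k t s * g s) ^ (5 : ℝ) :=
            setLIntegral_congr_fun measurableSet_Ioo fun t ht => by rw [hKint ht.2.le]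
        _ ≤ κ * ∫⁻ s in Ioo 0 T, g s ^ (5 : ℝ) := h
    simp only [hN₅, hκ']
    calc (∫⁻ t, Kop g t ^ (5 : ℝ) ∂μ) ^ (1 / 5 : ℝ) ≤ (κ * ∫⁻ s, g s ^ (5 : ℝ) ∂μ) ^ (1 / 5 : ℝ) :=
          ENNReal.rpow_le_rpow h' (by norm_num)
      _ = κ ^ (1 / 5 : ℝ) * (∫⁻ s, g s ^ (5 : ℝ) ∂μ) ^ (1 / 5 : ℝ) :=
          ENNReal.mul_rpow_of_nonneg _ _ (by norm_num)
  have hMink : ∀ {g₁ g₂ : ℝ → ℝ≥0∞}, Measurable g₁ → Measurable g₂ → N₅ (g₁ + g₂) ≤ N₅ g₁ + N₅ g₂ := by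
    intro g₁ g₂ hg₁ hg₂
    simp only [hN₅]
    exact ENNReal.lintegral_Lp_add_le hg₁.aemeasurable hg₂.aemeasurable (by norm_num : (1 : ℝ) ≤ 5)
  have hN₅_smul : ∀ (c : ℝ≥0∞) (g : ℝ → ℝ≥0∞), Measurable g → N₅ (fun t => c * g t) = c * N₅ g := by
    intro c g hg
    simp only [hN₅]
    have : ∫⁻ t, (c * g t) ^ (5 : ℝ) ∂μ = c ^ (5 : ℝ) * ∫⁻ t, g t ^ (5 : ℝ) ∂μ := by
      rw [← lintegral_const_mul _ (hg.pow_const _)]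
      exact lintegral_congr fun t => ENNReal.mul_rpow_of_nonneg _ _ (by norm_num)
    rw [this, ENNReal.mul_rpow_of_nonneg _ _ (by norm_num), ← ENNReal.rpow_mul]
    norm_num
  have hS_N₅ : ∀ N, N₅ (S N) ≤ 2 * N₅ ψ := by
    intro N
    induction N with
    | zero =>
        simp only [hN₅, hSdef, Function.iterate_zero, id_eq, Pi.zero_apply]
        rw [ENNReal.zero_rpow_of_pos (by norm_num), lintegral_zero, ENNReal.zero_rpow_of_pos (by norm_num)]
        exact bot_le
    | succ N ih =>
        have heq : S (N + 1) = ψ + fun t => Λ * Kop (S N) t := by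
          funext t; rw [hS_succ]; rfl
        calc N₅ (S (N + 1)) = N₅ (ψ + fun t => Λ * Kop (S N) t) := by rw [heq]
          _ ≤ N₅ ψ + N₅ (fun t => Λ * Kop (S N) t) := hMink hψm ((hKop_meas (hS_meas N)).const_mul _)
          _ = N₅ ψ + Λ * N₅ (Kop (S N)) := by rw [hN₅_smul _ _ (hKop_meas (hS_meas N))]
          _ ≤ N₅ ψ + Λ * (κ' * N₅ (S N)) := by gcongr; exact hSchur (hS_meas N)
          _ ≤ N₅ ψ + Λ * (κ' * (2 * N₅ ψ)) := by gcongr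
          _ = N₅ ψ + (Λ * κ') * 2 * N₅ ψ := by ring
          _ ≤ N₅ ψ + 2⁻¹ * 2 * N₅ ψ := by gcongr
          _ = 2 * N₅ ψ := by rw [ENNReal.inv_mul_cancel two_ne_zero ENNReal.ofNat_ne_top, one_mul, two_mul]
  -- from `N₅ (S N) ≤ 2 N₅ ψ` to the integrals
  have hS_int : ∀ N, ∫⁻ t, S N t ^ (5 : ℝ) ∂μ ≤ 32 * ∫⁻ t, ψ t ^ (5 : ℝ) ∂μ := by
    intro N
    have h := ENNReal.rpow_le_rpow (hS_N₅ N) (by norm_num : (0 : ℝ) ≤ 5)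
    simp only [hN₅] at h
    rw [ENNReal.mul_rpow_of_nonneg _ _ (by norm_num), ← ENNReal.rpow_mul, ← ENNReal.rpow_mul,
      show (1 / 5 : ℝ) * 5 = 1 by norm_num, ENNReal.rpow_one, ENNReal.rpow_one] at h
    have h32 : (2 : ℝ≥0∞) ^ (5 : ℝ) = 32 := by
      rw [show (5 : ℝ) = ((5 : ℕ) : ℝ) by norm_num, ENNReal.rpow_natCast]; norm_num
    rwa [h32] at h
  -- ### monotone convergence
  set e : ℝ≥0∞ ≃o ℝ≥0∞ := ENNReal.orderIsoRpow (5 : ℝ) (by norm_num) with he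
  have he_apply : ∀ x : ℝ≥0∞, e x = x ^ (5 : ℝ) := fun x => rfl
  have hsup : ∀ t, (⨆ N, S N t) ^ (5 : ℝ) = ⨆ N, S N t ^ (5 : ℝ) := by
    intro t
    rw [← he_apply, e.map_iSup]
    simp only [he_apply]
  calc ∫⁻ t in Ioo 0 T, φ t ^ (5 : ℝ) ≤ ∫⁻ t in Ioo 0 T, (⨆ N, S N t) ^ (5 : ℝ) :=
        setLIntegral_mono' measurableSet_Ioo fun t ht => ENNReal.rpow_le_rpow (hlim t ht) (by norm_num)
    _ = ∫⁻ t, ⨆ N, S N t ^ (5 : ℝ) ∂μ := by rw [hμ]; exact lintegral_congr fun t => hsup t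
    _ = ⨆ N, ∫⁻ t, S N t ^ (5 : ℝ) ∂μ := by
        refine lintegral_iSup (fun N => (hS_meas N).pow_const _) ?_
        intro N N' hNN' t
        exact ENNReal.rpow_le_rpow (hS_mono' hNN' t) (by norm_num)
    _ ≤ 32 * ∫⁻ t, ψ t ^ (5 : ℝ) ∂μ := iSup_le hS_int
    _ = 32 * ∫⁻ t in Ioo 0 T, ψ t ^ (5 : ℝ) := by rw [hμ]

end Literature.Analysis.FluidPDE
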